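import Literature.NumberTheory.Automorphic.TamagawaHeckeSeries
import Literature.NumberTheory.Automorphic.HeckeSeriesConvergence
import Literature.NumberTheory.Automorphic.CosetIntegral
import Literature.NumberTheory.Automorphic.GodementJacquetLocal
import Literature.NumberTheory.Automorphic.GodementJacquetLocalNonvanishing
import Literature.NumberTheory.Automorphic.JacquetModuleProofs
import HarnessLib

/-!
# Godement–Jacquet's Lemma 6.10 (the unramified computation) for bounded spherical coefficients

Topic `NumberTheory/Automorphic`; theorems only. Fourth layer of the decomposition of the named
fact `Literature.NumberTheory.Automorphic.godementJacquet_hasMeromorphicContinuation`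
(**lang.S21**; Godement–Jacquet (1972), Thm. 13.8): the **unramified local computation**

`Z(1_{M_n(𝒪)}, s + (n-1)/2, ω°) = ∏_{a ∈ α} (1 - a q^{-s})⁻¹ = L(s, π)`

(Godement–Jacquet, LNM 260 (1972), Lemma 6.10; Jacquet, Corvallis (1979), (1.4); Tamagawa
(1963)) for the zonal coefficient `ω°(g) = φ(π(g) v)` of a **spherical** representation
(`dim V^K = 1`, `K = GL_n(𝒪)`) with Satake parameter `α` (`IsSatakeParameter`, unitary
normalisation), under the hypothesis that `ω°` is **bounded** — the case of the local components
of (unitary) cuspidal automorphic representations, which is the case needed by lang.S21 — in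
place of the irreducibility/admissibility hypotheses of the named fact
`GodementJacquet1972_lemma610` (`GodementJacquetLocal`), whose general form requires the
asymptotics of admissible spherical functions (Macdonald's formula), absent from the tree.

## Proof (all proved, `gjLocalZeta_indicator_intMatrices_eq_of_norm_le`)

1. *Unfolding* (`setIntegral_isIntegralMatrix_eq`, from `CosetIntegral`): the integrand
   `1_{M_n(𝒪)}(x) f(x) |det x|^{s'}` is right-`K`-invariant, `M_n(𝒪) ∩ GL_n(F)` is the disjoint
   union of the `Δ_m = {|det| = q^{-m}}` (`setOf_isIntegralMatrix_eq_iUnion`, every non-zero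
   integer has valuation `|ϖ|^m`, `exists_valuation_eq_pow`, Mathlib's
   `IsDiscreteValuationRing 𝒪[F]`), each a finite union of left cosets
   (`finite_cosets_glIntDet` of `TamagawaHeckeSeries`), so
   `Z = μ(K) ∑_m q^{-m s'} ∑_{yK ⊆ Δ_m} f(y)` as soon as the double series converges absolutely.
2. *Sphericality* (`eq_smul_of_isSpherical`, `heckeDetOperator_apply_eq_smul_of_isSpherical`,
   `heckeOperator_apply_eq_smul_of_isSpherical`): with `φ(v) = 1`, every `K`-fixed vector is
   `φ(w) v`, so `T(ϖ^m) v = r_m v` with `r_m = ∑_{yK ⊆ Δ_m} f(y)`, and the `T_i`-eigenvalues of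
   the Satake vector transfer to `v`.
3. *Tamagawa* (`mk_heckeDetEigenvalue_mul_eulerFactor_eq_one` of `TamagawaHeckeSeries`):
   `(∑ r_m X^m) ∏_a (1 - q^{(n-1)/2} a X) = 1` in `ℂ⟦X⟧`.
4. *Convergence* (`tsum_mul_prod_one_sub_eq_one` of `HeckeSeriesConvergence`): `|r_m| ≤ B #(Δ_m K/K)
   ≤ B D^m`, `D = #(K t_1 K / K)` (`card_cosets_glIntDet_le_pow`), so for `q^{re s'} > D` — in
   particular for `re s > D + 1` — the Hecke series converges absolutely at `X = q^{-s'}` and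
   equals `∏_a (1 - a q^{-s})⁻¹` (`q^{(n-1)/2} a q^{-s'} = a q^{-s}`).

Hypothesis on the uniformizer: `|ϖ|_F = q⁻¹` (as in `IsSatakeParameter`'s users and
`GodementJacquet1972_lemma610`); `isUniformizingElement_of_normAbs_eq` shows that it makes `ϖ` a
uniformizing element (generator of `𝓂[F]`, the hypothesis of the Hecke-operator files), using
the uniformizer lemmas `DeltaCharBorel.normAbs_eq_zpow_log` / `valuation_lt_one_iff` of
`JacquetModuleProofs`.

## References

* R. Godement, H. Jacquet, *Zeta functions of simple algebras*, LNM 260 (1972), Lemma 6.10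
  [GodementJacquet1972] (not held; statement as recorded in `GodementJacquetLocal`).
* H. Jacquet, *Principal L-functions of the linear group*, Proc. Sympos. Pure Math. 33 (1979),
  Part 2, (1.4) [JacquetCorvallis1979].
* T. Tamagawa, *On the ζ-functions of a division algebra*, Ann. of Math. 77 (1963)
  [TamagawaAnnals1963]; G. Shimura, *Introduction to the arithmetic theory of automorphic
  functions* (1971), Thm. 3.21 [ShimuraIATAF1971].
-/

noncomputable section

open scoped Pointwise
open MulAction ValuativeRel Matrix Finset MeasureTheory Function
  Literature.LinearAlgebra.Matrix.Echelon Literature.NumberTheory.Automorphic.Echelon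

namespace Literature.NumberTheory.Automorphic

variable {F : Type*} [Field F] [ValuativeRel F] {n : ℕ}

section Lemma610Algebra

variable {ϖ : F}

/-- Integrality of matrices is invariant under `K = GL_n(𝒪)` on the right. [folklore] -/
theorem isIntegralMatrix_mul_glInt_iff {κ : GL (Fin n) F} (hκ : κ ∈ glInt n F)
    (y : GL (Fin n) F) :
    IsIntegralMatrix ((y * κ : GL (Fin n) F) : Matrix (Fin n) (Fin n) F) ↔
      IsIntegralMatrix (y : Matrix (Fin n) (Fin n) F) := by
  refine ⟨fun h => ?_, fun h => by rw [Units.val_mul]; exact h.mul (isIntegralMatrix_of_mem_glInt hκ)⟩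
  have e : (y : Matrix (Fin n) (Fin n) F) = ((y * κ : GL (Fin n) F) : Matrix (Fin n) (Fin n) F) *
      ((κ⁻¹ : GL (Fin n) F) : Matrix (Fin n) (Fin n) F) := by
    rw [← Units.val_mul, mul_assoc, mul_inv_cancel, mul_one]
  rw [e]
  exact h.mul (isIntegralMatrix_inv_of_mem_glInt hκ)

/-- In a valuation ring whose maximal ideal is generated by `ϖ` and which is a discrete
valuation ring (e.g. the ring of integers of a non-archimedean local field), every non-zero
element has valuation `|ϖ|^m` for some `m`. [folklore] -/
theorem exists_valuation_eq_pow [IsDiscreteValuationRing 𝒪[F]] (hϖ : IsUniformizingElement ϖ)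
    {x : F} (hx : x ∈ 𝒪[F]) (hx0 : x ≠ 0) : ∃ m : ℕ, valuation F x = valuation F ϖ ^ m := by
  have hirr : Irreducible (⟨ϖ, hϖ.mem⟩ : 𝒪[F]) :=
    IsDiscreteValuationRing.irreducible_of_span_eq_maximalIdeal _
      (fun h => hϖ.ne_zero (congrArg Subtype.val h)) hϖ.span_eq
  have hx0' : (⟨x, hx⟩ : 𝒪[F]) ≠ 0 := fun h => hx0 (congrArg Subtype.val h)
  obtain ⟨m, u, hu⟩ := IsDiscreteValuationRing.eq_unit_mul_pow_irreducible hx0' hirr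
  refine ⟨m, ?_⟩
  have hval : valuation F ((u : 𝒪[F]) : F) = 1 :=
    (Valuation.Integers.isUnit_iff_valuation_eq_one (Valuation.integer.integers (valuation F))).mp
      u.isUnit
  have e : x = ((u : 𝒪[F]) : F) * ϖ ^ m := by
    have := congrArg Subtype.val hu
    simpa using this
  rw [e, map_mul, map_pow, hval, one_mul]

/-- Every integral invertible matrix lies in some `Δ_m` (valuation of the determinant).
[folklore] -/
theorem exists_mem_glIntDet [IsDiscreteValuationRing 𝒪[F]] (hϖ : IsUniformizingElement ϖ)
    {x : GL (Fin n) F} (hx : IsIntegralMatrix (x : Matrix (Fin n) (Fin n) F)) :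
    ∃ m : ℕ, x ∈ glIntDet n ϖ m := by
  have hdet0 : (x : Matrix (Fin n) (Fin n) F).det ≠ 0 := by
    rw [← Matrix.GeneralLinearGroup.val_det_apply]; exact Units.ne_zero _
  obtain ⟨m, hm⟩ := exists_valuation_eq_pow hϖ hx.det_mem hdet0
  exact ⟨m, hx, hm⟩

/-- The index `m` of `Δ_m ∋ x` is unique (`|ϖ| < 1` is not `0` or `1`). [folklore] -/
theorem eq_of_mem_glIntDet (hϖ : IsUniformizingElement ϖ) {x : GL (Fin n) F} {m m' : ℕ}
    (hm : x ∈ glIntDet n ϖ m) (hm' : x ∈ glIntDet n ϖ m') : m = m' := by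
  have h : valuation F ϖ ^ m = valuation F ϖ ^ m' := hm.2.symm.trans hm'.2
  exact pow_right_injective₀ ((Valuation.pos_iff _).mpr hϖ.ne_zero) hϖ.valuation_lt_one.ne h

variable {k V : Type*} [Field k] [AddCommGroup V] [Module k V] (ρ : Representation k (GL (Fin n) F) V)

/-- In a **spherical** representation (`dim V^K = 1`) with `v ∈ V^K` and a `K`-invariant linear
form `φ` normalised by `φ v = 1`, every `K`-fixed vector `w` equals `φ(w) • v`. [folklore] -/
theorem eq_smul_of_isSpherical (hsph : ρ.IsSpherical (glInt n F)) {v : V}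
    (hv : v ∈ ρ.fixedPoints (glInt n F)) {φ : Module.Dual k V} (h1 : φ v = 1) {w : V}
    (hw : w ∈ ρ.fixedPoints (glInt n F)) : w = φ w • v := by
  have hv0 : (⟨v, hv⟩ : ρ.fixedPoints (glInt n F)) ≠ 0 := by
    intro h
    have : v = 0 := congrArg Subtype.val h
    rw [this, map_zero] at h1
    exact zero_ne_one h1
  rw [Representation.IsSpherical] at hsph
  obtain ⟨c, hc⟩ := (finrank_eq_one_iff_of_nonzero' _ hv0).mp hsph ⟨w, hw⟩
  have hc' : c • v = w := congrArg Subtype.val hc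
  rw [← hc', map_smul, h1, smul_eq_mul, mul_one]

/-- **Eigenvalues of `T(ϖ^m)` on a spherical vector.** With `v, φ` as above (`Δ_m K / K` finite),
`T(ϖ^m) v = r_m • v` with `r_m = φ(T(ϖ^m) v) = ∑_{yK ⊆ Δ_m} φ(ρ(y) v)` — the sum of the values
of the zonal coefficient `ω° = φ(ρ(·) v)` over the left cosets in `Δ_m`. [folklore] -/
theorem heckeDetOperator_apply_eq_smul_of_isSpherical (hsph : ρ.IsSpherical (glInt n F)) {v : V}
    (hv : v ∈ ρ.fixedPoints (glInt n F)) {φ : Module.Dual k V} (h1 : φ v = 1) (m : ℕ)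
    (hfin : {γ : GL (Fin n) F ⧸ glInt n F | γ.out ∈ glIntDet n ϖ m}.Finite) :
    heckeDetOperator ρ ϖ m v = (∑ γ ∈ hfin.toFinset, ρ.matrixCoeff φ v γ.out) • v := by
  have hmem := heckeDetOperator_apply_mem_fixedPoints ρ m hfin hv
  conv_lhs => rw [eq_smul_of_isSpherical ρ hsph hv h1 hmem]
  congr 1
  rw [heckeDetOperator_apply_eq_sum ρ m hfin, map_sum]
  rfl

/-- **Eigenvalues of `T_i` on a spherical vector from a Satake parameter**: if some non-zero
`K`-fixed `v'` has `T_i v' = τ_i • v'` (`i ≤ n`), then so does the normalised spherical vector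
`v` (both lie on the line `V^K`). [folklore] -/
theorem heckeOperator_apply_eq_smul_of_isSpherical (hsph : ρ.IsSpherical (glInt n F)) {v : V}
    (hv : v ∈ ρ.fixedPoints (glInt n F)) {φ : Module.Dual k V} (h1 : φ v = 1) {v' : V}
    (hv' : v' ∈ ρ.fixedPoints (glInt n F)) (hv'0 : v' ≠ 0) {g : GL (Fin n) F} {τ : k}
    (hτ : heckeOperator ρ (glInt n F) g v' = τ • v') :
    heckeOperator ρ (glInt n F) g v = τ • v := by
  have e := eq_smul_of_isSpherical ρ hsph hv h1 hv'
  have hc : φ v' ≠ 0 := by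
    intro h0; rw [h0, zero_smul] at e; exact hv'0 e
  rw [e, map_smul, smul_smul, mul_comm, ← smul_smul] at hτ
  exact smul_right_injective V hc hτ

end Lemma610Algebra

section Lemma610Local

open Literature.NumberTheory.GaloisRepresentations.IsNonarchimedeanLocalField MeasureTheory
open scoped NNReal

variable [TopologicalSpace F] [IsNonarchimedeanLocalField F] {ϖ : F}

/-- On `Δ_m`, `|det x|_F = |ϖ|_F^m` (the normalised absolute value factors through the
valuation). [folklore] -/
theorem normAbs_det_of_mem_glIntDet {x : GL (Fin n) F} {m : ℕ} (hx : x ∈ glIntDet n ϖ m) :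
    normAbs F ((Matrix.GeneralLinearGroup.det x : Fˣ) : F) = normAbs F ϖ ^ m := by
  rw [← map_pow]
  rw [normAbs_apply, normAbs_apply, Matrix.GeneralLinearGroup.val_det_apply, hx.2, ← map_pow]

/-- The union of the left cosets in a set `T ⊆ G ⧸ K` is open (`K = GL_n(𝒪)` is open).
[folklore] -/
theorem isOpen_setOf_mk_mem (T : Set (GL (Fin n) F ⧸ glInt n F)) :
    IsOpen {x : GL (Fin n) F | (x : GL (Fin n) F ⧸ glInt n F) ∈ T} := by
  have e : {x : GL (Fin n) F | (x : GL (Fin n) F ⧸ glInt n F) ∈ T} =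
      ⋃ γ ∈ T, {x : GL (Fin n) F | (x : GL (Fin n) F ⧸ glInt n F) = γ} := by
    ext x; simp
  rw [e]
  exact isOpen_biUnion fun γ _ => isOpen_setOf_mk_eq (isOpen_glInt n F) γ

omit [TopologicalSpace F] [IsNonarchimedeanLocalField F] in
/-- `Δ_m` as a subset of `GL_n(F)` is the union of the left cosets in `Δ_m K / K`. [folklore] -/
theorem setOf_mem_glIntDet_eq (m : ℕ) :
    {x : GL (Fin n) F | x ∈ glIntDet n ϖ m} =
      {x : GL (Fin n) F | (x : GL (Fin n) F ⧸ glInt n F) ∈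
        {γ : GL (Fin n) F ⧸ glInt n F | γ.out ∈ glIntDet n ϖ m}} := by
  ext x
  simp only [Set.mem_setOf_eq]
  exact (mk_out_mem_glIntDet_iff x).symm

variable {E : Type*} [NormedAddCommGroup E] [NormedSpace ℝ E] [CompleteSpace E]
  [MeasurableSpace (GL (Fin n) F)] [BorelSpace (GL (Fin n) F)]
  {μG : Measure (GL (Fin n) F)} [μG.IsMulLeftInvariant]

/-- **Integral of a right-`K`-invariant function over `Δ_m`**:
`∫_{Δ_m} F dμ = μ(K) • ∑_{yK ⊆ Δ_m} F(y)` (a finite sum, `finite_cosets_glIntDet`), with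
integrability. [folklore] -/
theorem setIntegral_glIntDet_eq [Finite 𝓀[F]] (hϖ : IsUniformizingElement ϖ) (hμK : μG (glInt n F) < ⊤)
    {Fn : GL (Fin n) F → E} (hF : ∀ x : GL (Fin n) F, ∀ k ∈ glInt n F, Fn (x * k) = Fn x) (m : ℕ) :
    IntegrableOn Fn {x : GL (Fin n) F | x ∈ glIntDet n ϖ m} μG ∧
      ∫ x in {x : GL (Fin n) F | x ∈ glIntDet n ϖ m}, Fn x ∂μG =
        (μG (glInt n F)).toReal • ∑ γ ∈ (finite_cosets_glIntDet hϖ m).toFinset, Fn γ.out := by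
  classical
  have hB := finite_cosets_glIntDet (n := n) hϖ m
  have eT : {x : GL (Fin n) F | (x : GL (Fin n) F ⧸ glInt n F) ∈ (hB.toFinset : Set _)} =
      {x : GL (Fin n) F | x ∈ glIntDet n ϖ m} := by
    ext x
    simp only [Set.mem_setOf_eq, Set.Finite.coe_toFinset]
    exact mk_out_mem_glIntDet_iff x
  obtain ⟨h1, h2⟩ := integral_setOf_mk_mem_eq_tsum (isOpen_glInt n F) hμK hF
    (hB.toFinset.finite_toSet.countable) (Summable.of_finite
      (f := fun γ : ((hB.toFinset : Set (GL (Fin n) F ⧸ glInt n F)) : Type _) =>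
        ‖Fn (γ.1 : GL (Fin n) F ⧸ glInt n F).out‖))
  rw [eT] at h1 h2
  refine ⟨h1, ?_⟩
  rw [h2]
  congr 1
  exact Finset.tsum_subtype hB.toFinset (fun γ => Fn γ.out)

omit [MeasurableSpace (GL (Fin n) F)] [BorelSpace (GL (Fin n) F)] in
/-- The integral matrices form the disjoint union of the `Δ_m`, `m ≥ 0`. [folklore] -/
theorem setOf_isIntegralMatrix_eq_iUnion (hϖ : IsUniformizingElement ϖ) :
    {x : GL (Fin n) F | IsIntegralMatrix (x : Matrix (Fin n) (Fin n) F)} =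
      ⋃ m : ℕ, {x : GL (Fin n) F | x ∈ glIntDet n ϖ m} := by
  ext x
  simp only [Set.mem_setOf_eq, Set.mem_iUnion]
  exact ⟨fun hx => exists_mem_glIntDet hϖ hx, fun ⟨m, hm⟩ => hm.1⟩

/-- **Integral of a right-`K`-invariant function over the integral matrices, unfolded**: if
`∑_m ∑_{yK ⊆ Δ_m} ‖F(y)‖ < ∞` then `F` is integrable on `M_n(𝒪) ∩ GL_n(F)` and
`∫_{M_n(𝒪) ∩ GL_n(F)} F dμ = μ(K) • ∑_m ∑_{yK ⊆ Δ_m} F(y)`. [folklore] -/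
theorem setIntegral_isIntegralMatrix_eq [Finite 𝓀[F]] (hϖ : IsUniformizingElement ϖ)
    (hμK : μG (glInt n F) < ⊤) {Fn : GL (Fin n) F → E}
    (hF : ∀ x : GL (Fin n) F, ∀ k ∈ glInt n F, Fn (x * k) = Fn x)
    (hsum : Summable fun m : ℕ => ∑ γ ∈ (finite_cosets_glIntDet hϖ m).toFinset, ‖Fn γ.out‖) :
    IntegrableOn Fn {x : GL (Fin n) F | IsIntegralMatrix (x : Matrix (Fin n) (Fin n) F)} μG ∧
      HasSum (fun m : ℕ => (μG (glInt n F)).toReal •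
          ∑ γ ∈ (finite_cosets_glIntDet hϖ m).toFinset, Fn γ.out)
        (∫ x in {x : GL (Fin n) F | IsIntegralMatrix (x : Matrix (Fin n) (Fin n) F)}, Fn x ∂μG) := by
  rw [setOf_isIntegralMatrix_eq_iUnion hϖ]
  have hm : ∀ m : ℕ, MeasurableSet {x : GL (Fin n) F | x ∈ glIntDet n ϖ m} := fun m => by
    rw [setOf_mem_glIntDet_eq]
    exact (isOpen_setOf_mk_mem _).measurableSet
  have hd : Pairwise (Disjoint on fun m : ℕ => {x : GL (Fin n) F | x ∈ glIntDet n ϖ m}) := by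
    intro m m' h
    rw [Function.onFun, Set.disjoint_left]
    intro x hx hx'
    exact h (eq_of_mem_glIntDet hϖ hx hx')
  have hnorm : ∀ x : GL (Fin n) F, ∀ k ∈ glInt n F, ‖Fn (x * k)‖ = ‖Fn x‖ := fun x k hk => by
    rw [hF x k hk]
  have hint : IntegrableOn Fn (⋃ m : ℕ, {x : GL (Fin n) F | x ∈ glIntDet n ϖ m}) μG := by
    refine integrableOn_iUnion_of_summable_integral_norm
      (fun m => (setIntegral_glIntDet_eq hϖ hμK hF m).1) ?_
    simp_rw [(setIntegral_glIntDet_eq hϖ hμK (Fn := fun x => ‖Fn x‖) hnorm _).2, smul_eq_mul]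
    exact hsum.mul_left _
  refine ⟨hint, ?_⟩
  have h := hasSum_integral_iUnion hm hd hint
  simp_rw [(setIntegral_glIntDet_eq hϖ hμK hF _).2] at h
  exact h

end Lemma610Local

section Lemma610Assembly

open Literature.NumberTheory.GaloisRepresentations.IsNonarchimedeanLocalField MeasureTheory
open scoped NNReal

/-- A positive real power identity: `((q^m)⁻¹)^s = (q^{-s})^m` for a natural base. [folklore] -/
theorem inv_natCast_pow_cpow (q m : ℕ) (s : ℂ) :
    (((q : ℂ) ^ m)⁻¹) ^ s = ((q : ℂ) ^ (-s)) ^ m := by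
  have hlog : (Complex.log (q : ℂ)).im = 0 := by
    rw [show (q : ℂ) = ((q : ℝ) : ℂ) by norm_cast, ← Complex.ofReal_log (Nat.cast_nonneg q)]
    exact Complex.ofReal_im _
  have him : (Complex.log (q : ℂ) * (-(m : ℂ))).im = 0 := by
    simp [Complex.mul_im, hlog]
  rw [← Complex.cpow_natCast, ← Complex.cpow_neg, ← Complex.cpow_nat_mul,
    ← Complex.cpow_mul _ (by rw [him]; exact neg_lt_zero.mpr Real.pi_pos)
      (by rw [him]; exact Real.pi_pos.le)]
  ring_nf

/-- The orbit `K · t_1 K` is finite and non-empty, so `D = #(K t_1 K / K) ≥ 1` (all `n`).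
[folklore] -/
theorem one_le_ncard_orbit_heckeDiag_one [Finite 𝓀[F]] {ϖ : F} (hϖ : IsUniformizingElement ϖ) :
    (MulAction.orbit (glInt n F) ((heckeDiag n (Units.mk0 ϖ hϖ.ne_zero) 1 : GL (Fin n) F) :
        GL (Fin n) F ⧸ glInt n F)).Finite ∧
    1 ≤ (MulAction.orbit (glInt n F) ((heckeDiag n (Units.mk0 ϖ hϖ.ne_zero) 1 : GL (Fin n) F) :
        GL (Fin n) F ⧸ glInt n F)).ncard := by
  have hfin : (MulAction.orbit (glInt n F) ((heckeDiag n (Units.mk0 ϖ hϖ.ne_zero) 1 :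
      GL (Fin n) F) : GL (Fin n) F ⧸ glInt n F)).Finite := by
    rcases Nat.eq_zero_or_pos n with hn | hn
    · subst hn
      haveI : Subsingleton (GL (Fin 0) F) := by
        refine ⟨fun a b => Units.ext (Subsingleton.elim _ _)⟩
      haveI : Finite (GL (Fin 0) F ⧸ glInt 0 F) := Quotient.finite _
      exact Set.toFinite _
    · exact finite_orbit_heckeDiag hϖ hn
  refine ⟨hfin, ?_⟩
  rw [Nat.one_le_iff_ne_zero, Ne, Set.ncard_eq_zero (hs := hfin)]
  exact (MulAction.nonempty_orbit _).ne_empty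

/-- The number of left cosets in `Δ_m` is at most `D^m`, `D = #(K t_1 K / K)`, for every `n`
(`ncard_cosets_glIntDet_le` for `n ≥ 1`; for `n = 0` the coset space is a point). [folklore] -/
theorem card_cosets_glIntDet_le_pow [Finite 𝓀[F]] {ϖ : F} (hϖ : IsUniformizingElement ϖ) (m : ℕ) :
    (finite_cosets_glIntDet (n := n) hϖ m).toFinset.card ≤
      (MulAction.orbit (glInt n F) ((heckeDiag n (Units.mk0 ϖ hϖ.ne_zero) 1 : GL (Fin n) F) :
        GL (Fin n) F ⧸ glInt n F)).ncard ^ m := by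
  classical
  rw [← Set.ncard_eq_toFinset_card _ (finite_cosets_glIntDet hϖ m)]
  rcases Nat.eq_zero_or_pos n with hn | hn
  · subst hn
    haveI : Subsingleton (GL (Fin 0) F) := ⟨fun a b => Units.ext (Subsingleton.elim _ _)⟩
    haveI : Subsingleton (GL (Fin 0) F ⧸ glInt 0 F) := Quotient.instSubsingletonQuotient _
    haveI : Finite {γ : GL (Fin 0) F ⧸ glInt 0 F | γ.out ∈ glIntDet 0 ϖ m} :=
      (finite_cosets_glIntDet hϖ m).to_subtype
    calc {γ : GL (Fin 0) F ⧸ glInt 0 F | γ.out ∈ glIntDet 0 ϖ m}.ncard ≤ 1 :=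
          Set.ncard_le_one_iff_subsingleton.mpr (Set.subsingleton_of_subsingleton)
      _ ≤ _ := Nat.one_le_pow _ _ (one_le_ncard_orbit_heckeDiag_one hϖ).2
  · exact ncard_cosets_glIntDet_le hϖ hn m

variable [TopologicalSpace F] [IsNonarchimedeanLocalField F]
  [MeasurableSpace (GL (Fin n) F)] [BorelSpace (GL (Fin n) F)]

omit [MeasurableSpace (GL (Fin n) F)] [BorelSpace (GL (Fin n) F)] in
/-- **`|ϖ|_F = q⁻¹` makes `ϖ` a uniformizing element** (a generator of the maximal ideal of
`𝒪[F]`): `|ϖ| = q^{log ψ(v ϖ)}` forces `ψ(v ϖ) = exp(-1)` (`ψ` Mathlib's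
`valueGroupWithZeroIsoInt`), and then `v x < 1 ↔ v x ≤ v ϖ`, i.e. `𝓂[F] = (ϖ)`
(`DeltaCharBorel.valuation_lt_one_iff` of `JacquetModuleProofs`). This bridges the hypothesis
`normAbs F ϖ = q⁻¹` of `IsSatakeParameter`'s users / `GodementJacquet1972_lemma610` and the
hypothesis `IsUniformizingElement` of the Hecke-operator files. [folklore] -/
theorem isUniformizingElement_of_normAbs_eq {ϖ : F}
    (hϖ : normAbs F ϖ = ((residueFieldCard F : ℝ≥0))⁻¹) : IsUniformizingElement ϖ := by
  have hq1 : (1 : ℝ≥0) < residueFieldCard F := by exact_mod_cast one_lt_residueFieldCard F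
  have hϖ0 : ϖ ≠ 0 := by
    intro h
    rw [h, map_zero] at hϖ
    exact (inv_ne_zero (by positivity)) hϖ.symm
  -- `ψ (v ϖ) = exp (-1)`
  have hexp : IsNonarchimedeanLocalField.valueGroupWithZeroIsoInt F (valuation F ϖ) =
      WithZero.exp (-1 : ℤ) := by
    have h := DeltaCharBorel.normAbs_eq_zpow_log hϖ0
    rw [hϖ, ← _root_.zpow_neg_one] at h
    have hlog : WithZero.log (IsNonarchimedeanLocalField.valueGroupWithZeroIsoInt F
        (valuation F ϖ)) = -1 := (zpow_right_injective₀ (by positivity) hq1.ne' h).symm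
    rw [← hlog, WithZero.exp_log (DeltaCharBorel.valueGroupWithZeroIsoInt_ne_zero hϖ0)]
  have hlt : valuation F ϖ < 1 := DeltaCharBorel.valuation_uniformizer_lt_one hexp
  have hmem : ϖ ∈ 𝒪[F] := (Valuation.mem_integer_iff _ _).mpr hlt.le
  refine ⟨hmem, hϖ0, ?_⟩
  ext x
  rw [IsLocalRing.mem_maximalIdeal, mem_nonunits_iff,
    Valuation.Integer.not_isUnit_iff_valuation_lt_one, Ideal.mem_span_singleton]
  change valuation F (x : F) < 1 ↔ _
  rw [DeltaCharBorel.valuation_lt_one_iff hexp]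
  constructor
  · intro hle
    refine ⟨⟨ϖ⁻¹ * x, ?_⟩, ?_⟩
    · rw [Valuation.mem_integer_iff, map_mul, map_inv₀]
      calc (valuation F ϖ)⁻¹ * valuation F (x : F) ≤ (valuation F ϖ)⁻¹ * valuation F ϖ :=
            mul_le_mul_right hle _
        _ = 1 := inv_mul_cancel₀ ((Valuation.ne_zero_iff _).mpr hϖ0)
    · apply Subtype.ext
      change (x : F) = ϖ * (ϖ⁻¹ * x)
      rw [← mul_assoc, mul_inv_cancel₀ hϖ0, one_mul]
  · rintro ⟨y, hy⟩
    have : (x : F) = ϖ * y := congrArg Subtype.val hy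
    rw [this, map_mul]
    calc valuation F ϖ * valuation F (y : F) ≤ valuation F ϖ * 1 :=
          mul_le_mul_right ((Valuation.mem_integer_iff _ _).mp y.2) _
      _ = valuation F ϖ := mul_one _

omit [MeasurableSpace (GL (Fin n) F)] [BorelSpace (GL (Fin n) F)] in
/-- The integrand of `Z(1_{M_n(𝒪)}, s, f)` is the indicator of the integral matrices times
`f(x) |det x|^s`. [folklore] -/
theorem gjLocalIntegrand_indicator_intMatrices (f : GL (Fin n) F → ℂ) (s : ℂ) (x : GL (Fin n) F) :
    gjLocalIntegrand ((intMatrices n F).indicator 1) f s x =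
      {y : GL (Fin n) F | IsIntegralMatrix (y : Matrix (Fin n) (Fin n) F)}.indicator
        (fun y => f y * ((((normAbs F ((Matrix.GeneralLinearGroup.det y : Fˣ) : F)) : ℝ≥0) : ℝ) :
          ℂ) ^ s) x := by
  unfold gjLocalIntegrand
  by_cases hx : IsIntegralMatrix (x : Matrix (Fin n) (Fin n) F)
  · have hx' : (x : Matrix (Fin n) (Fin n) F) ∈ intMatrices n F := (mem_intMatrices_iff _).2 hx
    rw [Set.indicator_of_mem hx', Set.indicator_of_mem (show x ∈ {y : GL (Fin n) F |
      IsIntegralMatrix (y : Matrix (Fin n) (Fin n) F)} from hx)]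
    simp
  · have hx' : (x : Matrix (Fin n) (Fin n) F) ∉ intMatrices n F := fun h =>
      hx ((mem_intMatrices_iff _).1 h)
    rw [Set.indicator_of_notMem hx', Set.indicator_of_notMem (show x ∉ {y : GL (Fin n) F |
      IsIntegralMatrix (y : Matrix (Fin n) (Fin n) F)} from hx)]
    simp

/-- **Godement–Jacquet's Lemma 6.10 (the unramified computation) for bounded spherical
coefficients.** Let `F` be a non-archimedean local field with `q` elements in the residue field,
`μG` a Haar measure on `GL_n(F)` giving `K = GL_n(𝒪)` volume `1`, `ρ` a representation on a complex
vector space which is **spherical** (`dim V^K = 1`) with Satake parameter `α`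
(`IsSatakeParameter ρ ϖ α`, unitary normalisation, `ϖ` a uniformizer: `|ϖ| = q⁻¹`), `v ∈ V^K` and `φ` a linear form with `φ(v) = 1`, and suppose the coefficient
`f(g) = φ(ρ(g) v)` is **bounded** (e.g. `ρ` unitary with `‖v‖ = ‖φ‖ = 1` — the case of the local
components of cuspidal automorphic representations). Then for `re s > #(K t_1 K / K) + 1` the local
zeta integral of `f` against `Φ° = 1_{M_n(𝒪)}` at `s + (n-1)/2` converges absolutely and

`Z(1_{M_n(𝒪)}, s + (n-1)/2, f) = ∏_{a ∈ α} (1 - a q^{-s})⁻¹ = L(s, π)`,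

the value of `(eulerPolynomial α)(q^{-s})⁻¹`. Proof: unfold the integral over the left cosets
`yK ⊆ M_n(𝒪)` (`setIntegral_isIntegralMatrix_eq`; on `Δ_m`, `|det| = q^{-m}`), recognise
`∑_{yK ⊆ Δ_m} f(y) = φ(T(ϖ^m) v) = r_m` (sphericality), and sum the Hecke series by Tamagawa's
identity in Satake form (`mk_heckeDetEigenvalue_mul_eulerFactor_eq_one`) and its analytic form
(`tsum_mul_prod_one_sub_eq_one`, with `|r_m| ≤ B · #(Δ_m K/K) ≤ B D^m`). This is the statement
of the named fact `GodementJacquet1972_lemma610` (`GodementJacquetLocal`) with the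
irreducibility/admissibility hypotheses replaced by the boundedness of the coefficient (which
holds in the unitary case relevant to `lang.S21`); Godement–Jacquet (1972), Lemma 6.10; Jacquet
(1979), (1.4); Tamagawa (1963). [cite: GodementJacquet1972, Lemma 6.10] -/
theorem gjLocalZeta_indicator_intMatrices_eq_of_norm_le (μG : Measure (GL (Fin n) F))
    [μG.IsMulLeftInvariant] (hμ : μG (glInt n F : Set (GL (Fin n) F)) = 1)
    {V : Type*} [AddCommGroup V] [Module ℂ V] (ρ : Representation ℂ (GL (Fin n) F) V)
    (hsph : ρ.IsSpherical (glInt n F)) {ϖ : Fˣ}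
    (hϖ : normAbs F (ϖ : F) = ((residueFieldCard F : ℝ≥0))⁻¹) {α : Multiset ℂ}
    (hα : IsSatakeParameter ρ ϖ α) {v : V} (hv : v ∈ ρ.fixedPoints (glInt n F))
    {φ : Module.Dual ℂ V} (h1 : φ v = 1) {B : ℝ} (hB : ∀ g, ‖ρ.matrixCoeff φ v g‖ ≤ B) :
    ∃ c : ℝ, ∀ s : ℂ, c < s.re →
      Integrable (gjLocalIntegrand ((intMatrices n F).indicator 1) (ρ.matrixCoeff φ v)
        (s + ((n : ℂ) - 1) / 2)) μG ∧
      gjLocalZeta μG ((intMatrices n F).indicator 1) (ρ.matrixCoeff φ v)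
          (s + ((n : ℂ) - 1) / 2) =
        ((eulerPolynomial α).eval ((residueFieldCard F : ℂ) ^ (-s)))⁻¹ := by
  classical
  have hϖu : IsUniformizingElement (ϖ : F) := isUniformizingElement_of_normAbs_eq hϖ
  -- notation and basic facts
  set q : ℕ := residueFieldCard F with hqdef
  have hq1 : 1 < q := one_lt_residueFieldCard F
  have hq0 : 0 < q := lt_trans zero_lt_one hq1
  have hqC : (q : ℂ) ≠ 0 := Nat.cast_ne_zero.mpr hq0.ne'
  set f : GL (Fin n) F → ℂ := ρ.matrixCoeff φ v with hfdef
  have e0 : Units.mk0 (ϖ : F) hϖu.ne_zero = ϖ := Units.mk0_val _ _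
  have hv0 : v ≠ 0 := fun h => by rw [h, map_zero] at h1; exact zero_ne_one h1
  have hB0 : 0 ≤ B := le_trans (norm_nonneg _) (hB 1)
  set D : ℕ := (MulAction.orbit (glInt n F) ((heckeDiag n (Units.mk0 (ϖ : F) hϖu.ne_zero) 1 :
    GL (Fin n) F) : GL (Fin n) F ⧸ glInt n F)).ncard with hDdef
  have hD1 : 1 ≤ D := (one_le_ncard_orbit_heckeDiag_one hϖu).2
  -- the eigenvalues `r_m` of `T(ϖ^m)` on `v`
  set r : ℕ → ℂ := fun m => ∑ γ ∈ (finite_cosets_glIntDet (n := n) hϖu m).toFinset, f γ.out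
    with hrdef
  have hr : ∀ m, heckeDetOperator ρ (ϖ : F) m v = r m • v := fun m =>
    heckeDetOperator_apply_eq_smul_of_isSpherical ρ hsph hv h1 m (finite_cosets_glIntDet hϖu m)
  -- the eigenvalues of `T_i` on `v` from the Satake parameter
  obtain ⟨hcard, v', hv', hv'0, hT⟩ := hα
  have hτ : ∀ i ≤ n, heckeOperator ρ (glInt n F) (heckeDiag n (Units.mk0 (ϖ : F) hϖu.ne_zero) i) v =
      ((((Real.sqrt (Nat.card 𝓀[F]) : ℝ) : ℂ) ^ (i * (n - i))) * α.esymm i) • v := by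
    intro i hi
    refine heckeOperator_apply_eq_smul_of_isSpherical ρ hsph hv h1 hv' hv'0 ?_
    rw [e0, ← heckeT_def, hT i hi]
    congr 1
    push_cast
    rfl
  -- the bound `‖r_m‖ ≤ B D^m`
  have hrB : ∀ m, ‖r m‖ ≤ B * (D : ℝ) ^ m := by
    intro m
    calc ‖r m‖ ≤ ∑ γ ∈ (finite_cosets_glIntDet (n := n) hϖu m).toFinset, ‖f γ.out‖ :=
          norm_sum_le _ _
      _ ≤ ∑ _γ ∈ (finite_cosets_glIntDet (n := n) hϖu m).toFinset, B :=
          Finset.sum_le_sum fun γ _ => hB _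
      _ = (finite_cosets_glIntDet (n := n) hϖu m).toFinset.card * B := by
          rw [Finset.sum_const, nsmul_eq_mul]
      _ ≤ (D : ℝ) ^ m * B :=
          mul_le_mul_of_nonneg_right (by exact_mod_cast card_cosets_glIntDet_le_pow hϖu m) hB0
      _ = B * (D : ℝ) ^ m := mul_comm _ _
  -- Tamagawa's identity in Satake form
  have hps := mk_heckeDetEigenvalue_mul_eulerFactor_eq_one ρ hϖu hv hv0 hcard hτ hr
  -- the abscissa
  refine ⟨(D : ℝ) + 1, fun s hs => ?_⟩
  set s' : ℂ := s + ((n : ℂ) - 1) / 2 with hs'def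
  set x : ℂ := (q : ℂ) ^ (-s') with hxdef
  have hres' : (D : ℝ) < s'.re := by
    have e1 : s'.re = s.re + ((n : ℝ) - 1) / 2 := by
      simp [hs'def, Complex.add_re, Complex.div_ofNat_re]
    rw [e1]
    have : (0 : ℝ) ≤ n := Nat.cast_nonneg n
    linarith
  have hxnorm : ‖x‖ = (q : ℝ) ^ (-s'.re) := by
    rw [hxdef, Complex.norm_natCast_cpow_of_pos hq0, Complex.neg_re]
  have hxD : ‖x‖ * D < 1 := by
    rw [hxnorm, Real.rpow_neg (Nat.cast_nonneg q), inv_mul_lt_iff₀ (Real.rpow_pos_of_pos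
      (Nat.cast_pos.mpr hq0) _), mul_one]
    calc (D : ℝ) < (2 : ℝ) ^ (D : ℝ) := by
          rw [Real.rpow_natCast]; exact_mod_cast Nat.lt_two_pow_self
      _ < (2 : ℝ) ^ s'.re := (Real.rpow_lt_rpow_left_iff one_lt_two).mpr hres'
      _ ≤ (q : ℝ) ^ s'.re := Real.rpow_le_rpow zero_le_two (by exact_mod_cast hq1)
          (le_trans (Nat.cast_nonneg D) hres'.le)
  -- the analytic form of the Hecke series
  obtain ⟨hsumr, hval⟩ := tsum_mul_prod_one_sub_eq_one hps (Nat.cast_nonneg D) hrB hxD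
  -- the integrand, unfolded over the cosets in `M_n(𝒪)`
  set Fn : GL (Fin n) F → ℂ := fun y => f y *
    ((((normAbs F ((Matrix.GeneralLinearGroup.det y : Fˣ) : F)) : ℝ≥0) : ℝ) : ℂ) ^ s' with hFndef
  have hFK : ∀ y : GL (Fin n) F, ∀ k ∈ glInt n F, Fn (y * k) = Fn y := by
    intro y k hk
    simp only [hFndef, hfdef, Representation.matrixCoeff, map_mul, Module.End.mul_apply,
      (ρ.mem_fixedPoints _ v).1 hv k hk, Units.val_mul, map_mul,
      normAbs_det_eq_one_of_mem_glInt hk, mul_one]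
  have hFval : ∀ m, ∀ γ ∈ (finite_cosets_glIntDet (n := n) hϖu m).toFinset,
      Fn γ.out = f γ.out * x ^ m := by
    intro m γ hγ
    rw [Set.Finite.mem_toFinset, Set.mem_setOf_eq] at hγ
    simp only [hFndef]
    congr 1
    rw [normAbs_det_of_mem_glIntDet hγ, hϖ, hxdef, ← inv_natCast_pow_cpow]
    congr 1
    push_cast
    rw [inv_pow]
  have hsumFn : Summable fun m : ℕ =>
      ∑ γ ∈ (finite_cosets_glIntDet (n := n) hϖu m).toFinset, ‖Fn γ.out‖ := by
    have hgeom : Summable fun m : ℕ => B * ((D : ℝ) * ‖x‖) ^ m :=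
      (summable_geometric_of_lt_one (mul_nonneg (Nat.cast_nonneg D) (norm_nonneg x))
        (by rwa [mul_comm])).mul_left B
    refine Summable.of_nonneg_of_le (fun m => Finset.sum_nonneg fun _ _ => norm_nonneg _)
      (fun m => ?_) hgeom
    calc ∑ γ ∈ (finite_cosets_glIntDet (n := n) hϖu m).toFinset, ‖Fn γ.out‖
        = ∑ γ ∈ (finite_cosets_glIntDet (n := n) hϖu m).toFinset, ‖f γ.out‖ * ‖x‖ ^ m := by
          refine Finset.sum_congr rfl fun γ hγ => ?_
          rw [hFval m γ hγ, norm_mul, norm_pow]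
      _ ≤ ∑ _γ ∈ (finite_cosets_glIntDet (n := n) hϖu m).toFinset, B * ‖x‖ ^ m :=
          Finset.sum_le_sum fun γ _ => mul_le_mul_of_nonneg_right (hB _) (pow_nonneg
            (norm_nonneg x) m)
      _ = (finite_cosets_glIntDet (n := n) hϖu m).toFinset.card * (B * ‖x‖ ^ m) := by
          rw [Finset.sum_const, nsmul_eq_mul]
      _ ≤ (D : ℝ) ^ m * (B * ‖x‖ ^ m) :=
          mul_le_mul_of_nonneg_right (by exact_mod_cast card_cosets_glIntDet_le_pow hϖu m)
            (mul_nonneg hB0 (pow_nonneg (norm_nonneg x) m))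
      _ = B * ((D : ℝ) * ‖x‖) ^ m := by ring
  have hμK : μG (glInt n F : Set (GL (Fin n) F)) < ⊤ := by rw [hμ]; exact ENNReal.one_lt_top
  obtain ⟨hint, hhas⟩ := setIntegral_isIntegralMatrix_eq (E := ℂ) hϖu hμK hFK hsumFn
  -- the unfolded integral is the Hecke series `∑ r_m x^m`
  have hhas' : HasSum (fun m : ℕ => r m * x ^ m)
      (∫ y in {y : GL (Fin n) F | IsIntegralMatrix (y : Matrix (Fin n) (Fin n) F)}, Fn y ∂μG) := by
    have e : (fun m : ℕ => (μG (glInt n F)).toReal •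
        ∑ γ ∈ (finite_cosets_glIntDet (n := n) hϖu m).toFinset, Fn γ.out) =
        fun m : ℕ => r m * x ^ m := by
      funext m
      rw [hμ, ENNReal.toReal_one, one_smul, hrdef, Finset.sum_mul]
      exact Finset.sum_congr rfl fun γ hγ => hFval m γ hγ
    rw [e] at hhas
    exact hhas
  -- measurability of the integral matrices (a union of open cosets)
  have hSm : MeasurableSet {y : GL (Fin n) F | IsIntegralMatrix (y : Matrix (Fin n) (Fin n) F)} := by
    rw [setOf_isIntegralMatrix_eq_iUnion hϖu]
    refine MeasurableSet.iUnion fun m => ?_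
    rw [setOf_mem_glIntDet_eq]
    exact (isOpen_setOf_mk_mem _).measurableSet
  have hintegrand : gjLocalIntegrand ((intMatrices n F).indicator 1) f s' =
      {y : GL (Fin n) F | IsIntegralMatrix (y : Matrix (Fin n) (Fin n) F)}.indicator Fn :=
    funext fun y => gjLocalIntegrand_indicator_intMatrices f s' y
  refine ⟨?_, ?_⟩
  · rw [hintegrand, integrable_indicator_iff hSm]
    exact hint
  · rw [gjLocalZeta, hintegrand, integral_indicator hSm, ← hhas'.tsum_eq,
      eq_inv_of_mul_eq_one_left hval]
    congr 1
    -- `∏ (1 - q^{(n-1)/2} a q^{-s'}) = eulerPolynomial α` at `q^{-s}`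
    rw [eval_eulerPolynomial]
    rcases Nat.eq_zero_or_pos n with hn | hn
    · subst hn
      rw [Multiset.card_eq_zero.mp hcard]
      simp
    · congr 1
      refine Multiset.map_congr rfl fun a _ => ?_
      have hcx : (((Real.sqrt (Nat.card 𝓀[F]) : ℝ) : ℂ) ^ (n - 1)) * x = (q : ℂ) ^ (-s) := by
        have h12 : ((Real.sqrt (Nat.card 𝓀[F]) : ℝ) : ℂ) = (q : ℂ) ^ ((1 / 2 : ℂ)) := by
          rw [show (Nat.card 𝓀[F] : ℝ) = (q : ℝ) from rfl, Real.sqrt_eq_rpow,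
            Complex.ofReal_cpow (Nat.cast_nonneg q)]
          push_cast
          rfl
        have hsq : (((Real.sqrt (Nat.card 𝓀[F]) : ℝ) : ℂ) ^ (n - 1)) =
            (q : ℂ) ^ (((n : ℂ) - 1) / 2) := by
          rw [h12, ← Complex.cpow_nat_mul,
            show ((n - 1 : ℕ) : ℂ) * (1 / 2) = ((n : ℂ) - 1) / 2 by
              push_cast [Nat.cast_sub hn]; ring]
        rw [hsq, hxdef, hs'def, ← Complex.cpow_add _ _ hqC,
          show ((n : ℂ) - 1) / 2 + -(s + ((n : ℂ) - 1) / 2) = -s by ring]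
      rw [mul_assoc, mul_comm a x, ← mul_assoc, hcx, mul_comm]

end Lemma610Assembly

end Literature.NumberTheory.Automorphic
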